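/-
Copyright: the b2b-balaban T⁴-continuum CRUX team, row NE7b OWNER lineage `t4-ne7b-p1` (gen 129). Project licence.
-/
import Summits.QuantumFields.BalabanUV.T4Continuum.Spine.NE7b.SupLargeFieldCellsRare

/-!
# THE LARGE-FIELD PENALTY IS PAID BY THE NEXT GAUSSIAN STEP: the WEIGHTED Peierls brick
# `∫ 1_{∀p∈L: Ψ² ≤ Σ_{cell p}ψ²} · e^{bΣ_{x∈⋃L}ψ_x²} dN(0,Γ') ≤ (e^{−(κ∕2−b)Ψ²}·A^v)^{#L}` (`0 ≤ b ≤ κ∕2`, `κγ_op ≤ θ < 1`) — the quadratic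
# growth `e^{bΣψ²}` that the all-field assembly (307) charges per large-field site is absorbed by the Gaussian improbability of a large field,
# MULTIPLICATIVELY in the number of cells — and its RESUMMATION over the large-field region as a random subset of `C`:
# `∫ ∏_{p∈C}(1 + 1_{p large}·e^{a}·e^{bΣ_{cell p}ψ²}) dN(0,Γ') ≤ (1 + e^{a}·e^{−(κ∕2−b)Ψ²}A^v)^{#C} ≤ exp(#C·e^{a}η_b)` — an EXTENSIVE
# `O(η)` cost (row NE7b, node U5c; (288)∕(294) BY NAME + `Finset.prod_one_add`, `Finset.prod_boole`, the binomial resummation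
# `Finset.sum_pow_mul_eq_add_pow`; [folklore])

Cell `pub-balaban`, sub-cell `t4`, spine estimate NE7b (`T4WeightBudget.RelWeightBound`; the cell's OWN estimate — NOT PRINTED in
[Bałaban 1983–89], NOT PROVED).  Crux-route work under `Spine/NE7b/` by the row OWNER (`t4-ne7b-p1` gen 129, file (308)) under FREEZE
(0)'s crux-prover clause, on § [NE7bP1-G128-HANDOFF] NEXT (3)(b) («resum (294)'s `(e^{−½κΨ²}A^v)^{#L}` against … — coupling with (297)'s
weights»); NOTHING of Bałaban's is named as a Lean object, valued or asserted; no `T4Continuum/Support` leaf typed; no `def`, no notation;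
zero `sorry`.  Imports (BY NAME): the OWNER's (294) `…SupLargeFieldCellsRare` (`sum_biUnion_ge_of_cells`) and through it (288)
(`integral_exp_half_sq_on_le`, `integrable_exp_half_sq_on`) and (289) (`card_biUnion_cell_le`, `one_le_regulatorCost`); Mathlib's
`Finset.prod_one_add`, `Finset.prod_boole`, `Finset.sum_pow_mul_eq_add_pow`, `Finset.measurableSet_biInter`, `integral_finset_sum`,
`integral_mono_of_nonneg`, `Real.add_one_le_exp`.

WHY (located).  (307) bounds `|log Z_ψ(C)|` at EVERY `ψ` by `c·#S(ψ) + Σ_{p∈L(ψ)}(a + bΣ_{cell p}ψ²)`, `L(ψ)` = the cells where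
`Σ_{cell p}ψ² > Ψ²`.  At the next step `ψ` is itself Gaussian with a regulator margin `κ`; exponentiating, `e^{t|log Z_ψ(C)|} ≤
e^{tc#C}·∏_{p∈C}(1 + 1_{p large}e^{ta}e^{tbΣ_{cell p}ψ²})`, and the expectation of the product expands over the large-field region
`L ⊆ C` into the weighted bricks of §2: each costs `(e^{ta}η)^{#L}`, `η = e^{−(κ∕2−tb)Ψ²}A^v`, and `Σ_{L⊆C}(e^{ta}η)^{#L} = (1+e^{ta}η)^{#C}`.
So the large-field penalty of the step is an extensive `O(η)` — exponentially small in `κΨ²` — at the next scale ((309) assembles).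

WHAT IS PROVED ([folklore]; `μ = N(0,Γ)` on `ι → ℝ`, `Γ ⪰ 0`, `Γ ⪯ γ_op·1`, diagonal `≤ γ` (`γ ≥ 0`), cells pairwise disjoint of `≤ v`
sites, `0 ≤ κ`, `0 < θ < 1`, `κγ_op ≤ θ`, `A = (1−θ)^{−κγ∕(2θ)}`):
* §1 pointwise ∕ measurability: `indicator_mul_exp_le` (`1_{L large}e^{bΣ_{⋃L}ψ²} ≤ e^{−(κ∕2−b)#LΨ²}e^{½κΣ_{⋃L}ψ²}` for `b ≤ κ∕2`),
  `measurableSet_largeCells`, `measurable_indicator_largeCells`, `integrable_indicator_mul_exp`;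
* §2 THE WEIGHTED BRICK **`integral_indicator_mul_exp_le`**: `∫ 1_{∀p∈L large}·e^{bΣ_{⋃L}ψ²} dμ ≤ (e^{−(κ∕2−b)Ψ²}A^v)^{#L}` (`0 ≤ b ≤ κ∕2`);
* §3 the cell-product bookkeeping: `prod_cellWeight_eq` (`∏_{p∈L}1_{p large}e^{a}e^{bΣ_{cell p}ψ²} = e^{a#L}·1_{L large}·e^{bΣ_{⋃L}ψ²}`),
  `integrable_prod_cellWeight`, `integral_prod_cellWeight_le` (`≤ (e^{a}η)^{#L}`);
* §4 THE RESUMMATION **`integral_prod_one_add_cellWeight_le`** (`∫∏_{p∈C}(1 + 1_{p large}e^{a}e^{bΣ_{cell p}ψ²}) ≤ (1 + e^{a}η)^{#C}`) and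
  **`integral_prod_one_add_cellWeight_le_exp`** (`≤ exp(#C·e^{a}η)`), `η = e^{−(κ∕2−b)Ψ²}A^v`; §5 toy.

HONEST (what this is NOT).  Gaussian bookkeeping for the NEXT step's field; the pairing with (307)'s bound at fixed `ψ` into the
two-scale statement is (309); LOCAL versions (regions through a given cell, (304)'s lattice animals) are not needed for the extensive
statement and not repeated; scalar skeleton ((A3), NC-NE7b-α UNRULED); nothing of Bałaban's asserted.  BY-NAME EFFECT ON THE WALL: NONE.  NE7b
NOT PRINTED ∕ NOT PROVED; spine PROVED 0∕9; rung (B)+1 — the programme's measures remain FINITE-torus statements; NOT the mass gap, NOT Clay.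
HONEST DEPENDENCY: continuum YM on T⁴ ⇐ BetaPertH ∧ nine spine estimates (0∕9 proved); BetaPertH ⇐ (D1) ∧ (D4) ∧ CAP+tail; G-an2-4 gates
asym, D1 and NE2∕3∕4.
-/

set_option autoImplicit false

noncomputable section

namespace Summit.QuantumFields.BalabanUV.T4Continuum.NE7b.SupLargeFieldPenaltyPaid

open MeasureTheory ProbabilityTheory Finset Real
open scoped BigOperators
open SupGaussianRegulator (integral_exp_half_sq_on_le integrable_exp_half_sq_on)
open SupRegulatedActivityBound (card_biUnion_cell_le one_le_regulatorCost)
open SupLargeFieldCellsRare (sum_biUnion_ge_of_cells)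

variable {ι : Type} [Fintype ι] [DecidableEq ι] {V : Type*} [DecidableEq V]

/-! ## §1. Pointwise bound, measurability, integrability -/

omit [Fintype ι] in
/-- **On «all cells of `L` large» the quadratic weight is absorbed by the regulator**: for pairwise disjoint cells and `b ≤ κ∕2`,
`1_{∀p∈L: Ψ² ≤ Σ_{cell p}ψ²}·e^{bΣ_{x∈⋃L}ψ_x²} ≤ e^{−(κ∕2−b)·#L·Ψ²}·e^{½κΣ_{x∈⋃L}ψ_x²}`. [folklore] -/
theorem indicator_mul_exp_le (cell : V → Finset ι) (hdisj : ∀ p q, p ≠ q → Disjoint (cell p) (cell q)) (L : Finset V) {Ψ b κ : ℝ}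
    (hb : b ≤ κ / 2) (ω : EuclideanSpace ℝ ι) :
    (if ∀ p ∈ L, Ψ ^ 2 ≤ ∑ x ∈ cell p, ω x ^ 2 then (1 : ℝ) else 0) * exp (b * ∑ x ∈ L.biUnion cell, ω x ^ 2) ≤
      exp (-((κ / 2 - b) * (L.card * Ψ ^ 2))) * exp (κ * (∑ x ∈ L.biUnion cell, ω x ^ 2) / 2) := by
  split_ifs with hL
  · have hge := sum_biUnion_ge_of_cells cell hdisj L ω hL
    rw [one_mul, ← exp_add]
    refine exp_le_exp.2 ?_
    have h1 : (κ / 2 - b) * (L.card * Ψ ^ 2) ≤ (κ / 2 - b) * ∑ x ∈ L.biUnion cell, ω x ^ 2 :=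
      mul_le_mul_of_nonneg_left hge (by linarith)
    linarith
  · rw [zero_mul]
    positivity

omit [Fintype ι] [DecidableEq ι] [DecidableEq V] in
/-- The event «all cells of `L` are large at level `Ψ`» is measurable. [folklore] -/
theorem measurableSet_largeCells (cell : V → Finset ι) (L : Finset V) (Ψ : ℝ) :
    MeasurableSet {ω : EuclideanSpace ℝ ι | ∀ p ∈ L, Ψ ^ 2 ≤ ∑ x ∈ cell p, ω x ^ 2} := by
  have hset : {ω : EuclideanSpace ℝ ι | ∀ p ∈ L, Ψ ^ 2 ≤ ∑ x ∈ cell p, ω x ^ 2} =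
      ⋂ p ∈ L, {ω : EuclideanSpace ℝ ι | Ψ ^ 2 ≤ ∑ x ∈ cell p, ω x ^ 2} := by
    ext ω
    simp only [Set.mem_setOf_eq, Set.mem_iInter]
  rw [hset]
  refine Finset.measurableSet_biInter L fun p _ => measurableSet_le measurable_const ?_
  exact Finset.measurable_sum (cell p) fun x _ => ((by fun_prop : Measurable fun ω : EuclideanSpace ℝ ι => ω x).pow_const 2)

omit [Fintype ι] [DecidableEq ι] [DecidableEq V] in
/-- The indicator of «all cells of `L` large» is measurable. [folklore] -/
theorem measurable_indicator_largeCells (cell : V → Finset ι) (L : Finset V) (Ψ : ℝ) :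
    Measurable fun ω : EuclideanSpace ℝ ι => (if ∀ p ∈ L, Ψ ^ 2 ≤ ∑ x ∈ cell p, ω x ^ 2 then (1 : ℝ) else 0) :=
  Measurable.ite (measurableSet_largeCells cell L Ψ) measurable_const measurable_const

omit [Fintype ι] [DecidableEq ι] in
/-- The quadratic weight on a site set is measurable. [folklore] -/
theorem measurable_exp_mul_sum_sq (Y : Finset ι) (b : ℝ) :
    Measurable fun ω : EuclideanSpace ℝ ι => exp (b * ∑ x ∈ Y, ω x ^ 2) :=
  measurable_exp.comp ((Finset.measurable_sum Y fun x _ =>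
    ((by fun_prop : Measurable fun ω : EuclideanSpace ℝ ι => ω x).pow_const 2)).const_mul b)

/-- The weighted indicator is integrable under `N(0,Γ)` (`Γ ⪰ 0`, `Γ ⪯ γ_op·1`, `0 ≤ κ`, `κγ_op ≤ θ < 1`, `b ≤ κ∕2`): dominated by
`e^{−(κ∕2−b)#LΨ²}` times (288)'s integrable regulator. [folklore] -/
theorem integrable_indicator_mul_exp {Γ : Matrix ι ι ℝ} {γop : ℝ} (hΓ : Γ.PosSemidef) (hΓop : (γop • (1 : Matrix ι ι ℝ) - Γ).PosSemidef)
    (cell : V → Finset ι) (hdisj : ∀ p q, p ≠ q → Disjoint (cell p) (cell q)) {κ θ b : ℝ} (hκ : 0 ≤ κ) (hθ1 : θ < 1)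
    (hκθ : κ * γop ≤ θ) (hb : b ≤ κ / 2) (L : Finset V) (Ψ : ℝ) :
    Integrable (fun ω : EuclideanSpace ℝ ι => (if ∀ p ∈ L, Ψ ^ 2 ≤ ∑ x ∈ cell p, ω x ^ 2 then (1 : ℝ) else 0) *
      exp (b * ∑ x ∈ L.biUnion cell, ω x ^ 2)) (multivariateGaussian 0 Γ) := by
  have hint := integrable_exp_half_sq_on hΓ hΓop hκ hθ1 hκθ (L.biUnion cell)
  refine (hint.const_mul (exp (-((κ / 2 - b) * (L.card * Ψ ^ 2))))).mono'
    ((measurable_indicator_largeCells cell L Ψ).mul (measurable_exp_mul_sum_sq (L.biUnion cell) b)).aestronglyMeasurable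
    (ae_of_all _ fun ω => ?_)
  have hnn : 0 ≤ (if ∀ p ∈ L, Ψ ^ 2 ≤ ∑ x ∈ cell p, ω x ^ 2 then (1 : ℝ) else 0) * exp (b * ∑ x ∈ L.biUnion cell, ω x ^ 2) := by
    refine mul_nonneg ?_ (exp_pos _).le
    split_ifs <;> norm_num
  rw [Real.norm_of_nonneg hnn]
  exact indicator_mul_exp_le cell hdisj L hb ω

/-! ## §2. The weighted Peierls brick -/

/-- **THE WEIGHTED PEIERLS BRICK — A QUADRATIC WEIGHT ON LARGE-FIELD CELLS IS PAID BY THEIR RARITY, MULTIPLICATIVELY.**  `Γ ⪰ 0`,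
`Γ ⪯ γ_op·1`, diagonal `≤ γ` (`γ ≥ 0`); pairwise disjoint cells of `≤ v` sites; `0 ≤ κ`, `0 < θ < 1`, `κγ_op ≤ θ`; `0 ≤ b ≤ κ∕2` ⟹ for every
finite family `L` of cells and every `Ψ`:
`∫ 1_{∀p∈L: Ψ² ≤ Σ_{cell p}ψ²}·e^{bΣ_{x∈⋃L}ψ_x²} dN(0,Γ) ≤ (e^{−(κ∕2−b)Ψ²}·A^v)^{#L}`, `A = (1−θ)^{−κγ∕(2θ)}`. [folklore] -/
theorem integral_indicator_mul_exp_le {Γ : Matrix ι ι ℝ} {γop γ : ℝ} (hΓ : Γ.PosSemidef)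
    (hΓop : (γop • (1 : Matrix ι ι ℝ) - Γ).PosSemidef) (hdiag : ∀ i, Γ i i ≤ γ) (hγ : 0 ≤ γ) (cell : V → Finset ι)
    (hdisj : ∀ p q, p ≠ q → Disjoint (cell p) (cell q)) {v : ℕ} (hv : ∀ p, (cell p).card ≤ v) {κ θ b : ℝ} (hκ : 0 ≤ κ) (hθ0 : 0 < θ)
    (hθ1 : θ < 1) (hκθ : κ * γop ≤ θ) (hb : b ≤ κ / 2) (L : Finset V) (Ψ : ℝ) :
    ∫ ω : EuclideanSpace ℝ ι, (if ∀ p ∈ L, Ψ ^ 2 ≤ ∑ x ∈ cell p, ω x ^ 2 then (1 : ℝ) else 0) *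
        exp (b * ∑ x ∈ L.biUnion cell, ω x ^ 2) ∂(multivariateGaussian 0 Γ) ≤
      (exp (-((κ / 2 - b) * Ψ ^ 2)) * ((1 - θ) ^ (-(κ * γ / (2 * θ)))) ^ v) ^ L.card := by
  set μ := multivariateGaussian 0 Γ with hμ
  set A : ℝ := (1 - θ) ^ (-(κ * γ / (2 * θ))) with hA
  have hA1 : 1 ≤ A := one_le_regulatorCost (mul_nonneg hκ hγ) hθ0 hθ1
  have hint := integrable_exp_half_sq_on hΓ hΓop hκ hθ1 hκθ (L.biUnion cell)
  have hgauss := integral_exp_half_sq_on_le hΓ hΓop hκ hθ0 hθ1 hκθ (L.biUnion cell) fun i _ => hdiag i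
  calc ∫ ω : EuclideanSpace ℝ ι, (if ∀ p ∈ L, Ψ ^ 2 ≤ ∑ x ∈ cell p, ω x ^ 2 then (1 : ℝ) else 0) *
        exp (b * ∑ x ∈ L.biUnion cell, ω x ^ 2) ∂μ
      ≤ ∫ ω : EuclideanSpace ℝ ι, exp (-((κ / 2 - b) * (L.card * Ψ ^ 2))) * exp (κ * (∑ x ∈ L.biUnion cell, ω x ^ 2) / 2) ∂μ :=
        integral_mono_of_nonneg (ae_of_all _ fun ω => mul_nonneg (by split_ifs <;> norm_num) (exp_pos _).le) (hint.const_mul _)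
          (ae_of_all _ fun ω => indicator_mul_exp_le cell hdisj L hb ω)
    _ = exp (-((κ / 2 - b) * (L.card * Ψ ^ 2))) * ∫ ω : EuclideanSpace ℝ ι, exp (κ * (∑ x ∈ L.biUnion cell, ω x ^ 2) / 2) ∂μ :=
        integral_const_mul _ _
    _ ≤ exp (-((κ / 2 - b) * (L.card * Ψ ^ 2))) * A ^ (L.biUnion cell).card := mul_le_mul_of_nonneg_left hgauss (exp_pos _).le
    _ ≤ exp (-((κ / 2 - b) * (L.card * Ψ ^ 2))) * A ^ (v * L.card) :=
        mul_le_mul_of_nonneg_left (pow_le_pow_right₀ hA1 (card_biUnion_cell_le cell hv L)) (exp_pos _).le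
    _ = (exp (-((κ / 2 - b) * Ψ ^ 2)) * A ^ v) ^ L.card := by
        rw [mul_pow, ← pow_mul, ← Real.exp_nat_mul]
        congr 2
        ring

/-! ## §3. The cell-product bookkeeping -/

omit [Fintype ι] [DecidableEq V] in
/-- **The product of the cell weights over `L`**: `∏_{p∈L}(1_{p large}·(e^{a}·e^{bΣ_{cell p}ψ²})) = e^{#L·a}·(1_{∀p∈L large}·e^{bΣ_{x∈⋃L}ψ_x²})`
(pairwise disjoint cells). [folklore] -/
theorem prod_cellWeight_eq (cell : V → Finset ι) (hdisj : ∀ p q, p ≠ q → Disjoint (cell p) (cell q)) (L : Finset V) (Ψ a b : ℝ)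
    (ω : EuclideanSpace ℝ ι) :
    ∏ p ∈ L, ((if Ψ ^ 2 ≤ ∑ x ∈ cell p, ω x ^ 2 then (1 : ℝ) else 0) * (exp a * exp (b * ∑ x ∈ cell p, ω x ^ 2))) =
      exp (L.card * a) * ((if ∀ p ∈ L, Ψ ^ 2 ≤ ∑ x ∈ cell p, ω x ^ 2 then (1 : ℝ) else 0) *
        exp (b * ∑ x ∈ L.biUnion cell, ω x ^ 2)) := by
  have hpd : (L : Set V).PairwiseDisjoint cell := fun p _ q _ hpq => hdisj p q hpq
  rw [prod_mul_distrib, prod_boole, prod_mul_distrib, prod_const, ← Real.exp_sum, sum_biUnion hpd, mul_sum, ← exp_nat_mul]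
  ring

/-- The product of the cell weights over `L` is integrable (`b ≤ κ∕2`). [folklore] -/
theorem integrable_prod_cellWeight {Γ : Matrix ι ι ℝ} {γop : ℝ} (hΓ : Γ.PosSemidef) (hΓop : (γop • (1 : Matrix ι ι ℝ) - Γ).PosSemidef)
    (cell : V → Finset ι) (hdisj : ∀ p q, p ≠ q → Disjoint (cell p) (cell q)) {κ θ b : ℝ} (hκ : 0 ≤ κ) (hθ1 : θ < 1)
    (hκθ : κ * γop ≤ θ) (hb : b ≤ κ / 2) (L : Finset V) (Ψ a : ℝ) :
    Integrable (fun ω : EuclideanSpace ℝ ι => ∏ p ∈ L, ((if Ψ ^ 2 ≤ ∑ x ∈ cell p, ω x ^ 2 then (1 : ℝ) else 0) *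
      (exp a * exp (b * ∑ x ∈ cell p, ω x ^ 2)))) (multivariateGaussian 0 Γ) := by
  simp_rw [prod_cellWeight_eq cell hdisj L Ψ a b]
  exact (integrable_indicator_mul_exp hΓ hΓop cell hdisj hκ hθ1 hκθ hb L Ψ).const_mul _

/-- **Each term of the expansion is a weighted brick**: `∫∏_{p∈L}(1_{p large}e^{a}e^{bΣ_{cell p}ψ²}) dN(0,Γ) ≤ (e^{a}·e^{−(κ∕2−b)Ψ²}A^v)^{#L}`.
[folklore] -/
theorem integral_prod_cellWeight_le {Γ : Matrix ι ι ℝ} {γop γ : ℝ} (hΓ : Γ.PosSemidef)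
    (hΓop : (γop • (1 : Matrix ι ι ℝ) - Γ).PosSemidef) (hdiag : ∀ i, Γ i i ≤ γ) (hγ : 0 ≤ γ) (cell : V → Finset ι)
    (hdisj : ∀ p q, p ≠ q → Disjoint (cell p) (cell q)) {v : ℕ} (hv : ∀ p, (cell p).card ≤ v) {κ θ b : ℝ} (hκ : 0 ≤ κ) (hθ0 : 0 < θ)
    (hθ1 : θ < 1) (hκθ : κ * γop ≤ θ) (hb : b ≤ κ / 2) (L : Finset V) (Ψ a : ℝ) :
    ∫ ω : EuclideanSpace ℝ ι, ∏ p ∈ L, ((if Ψ ^ 2 ≤ ∑ x ∈ cell p, ω x ^ 2 then (1 : ℝ) else 0) *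
        (exp a * exp (b * ∑ x ∈ cell p, ω x ^ 2))) ∂(multivariateGaussian 0 Γ) ≤
      (exp a * (exp (-((κ / 2 - b) * Ψ ^ 2)) * ((1 - θ) ^ (-(κ * γ / (2 * θ)))) ^ v)) ^ L.card := by
  simp_rw [prod_cellWeight_eq cell hdisj L Ψ a b]
  rw [integral_const_mul, mul_pow, ← exp_nat_mul]
  exact mul_le_mul_of_nonneg_left (integral_indicator_mul_exp_le hΓ hΓop hdiag hγ cell hdisj hv hκ hθ0 hθ1 hκθ hb L Ψ) (exp_pos _).le

/-! ## §4. The resummation over the large-field region -/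

/-- **THE RESUMMATION — THE LARGE-FIELD PENALTY IS AN EXTENSIVE `O(η)`.**  `Γ ⪰ 0`, `Γ ⪯ γ_op·1`, diagonal `≤ γ` (`γ ≥ 0`); pairwise
disjoint cells of `≤ v` sites; `0 ≤ κ`, `0 < θ < 1`, `κγ_op ≤ θ`; `b ≤ κ∕2` ⟹ for every finite cell set `C` and all `Ψ, a`:
`∫ ∏_{p∈C}(1 + 1_{Ψ² ≤ Σ_{cell p}ψ²}·e^{a}·e^{bΣ_{cell p}ψ²}) dN(0,Γ) ≤ (1 + e^{a}·e^{−(κ∕2−b)Ψ²}A^v)^{#C}`, `A = (1−θ)^{−κγ∕(2θ)}`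
(expand the product over the large-field region `L ⊆ C`, bound each term by §3, resum binomially). [folklore] -/
theorem integral_prod_one_add_cellWeight_le {Γ : Matrix ι ι ℝ} {γop γ : ℝ} (hΓ : Γ.PosSemidef)
    (hΓop : (γop • (1 : Matrix ι ι ℝ) - Γ).PosSemidef) (hdiag : ∀ i, Γ i i ≤ γ) (hγ : 0 ≤ γ) (cell : V → Finset ι)
    (hdisj : ∀ p q, p ≠ q → Disjoint (cell p) (cell q)) {v : ℕ} (hv : ∀ p, (cell p).card ≤ v) {κ θ b : ℝ} (hκ : 0 ≤ κ) (hθ0 : 0 < θ)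
    (hθ1 : θ < 1) (hκθ : κ * γop ≤ θ) (hb : b ≤ κ / 2) (C : Finset V) (Ψ a : ℝ) :
    ∫ ω : EuclideanSpace ℝ ι, ∏ p ∈ C, (1 + (if Ψ ^ 2 ≤ ∑ x ∈ cell p, ω x ^ 2 then (1 : ℝ) else 0) *
        (exp a * exp (b * ∑ x ∈ cell p, ω x ^ 2))) ∂(multivariateGaussian 0 Γ) ≤
      (1 + exp a * (exp (-((κ / 2 - b) * Ψ ^ 2)) * ((1 - θ) ^ (-(κ * γ / (2 * θ)))) ^ v)) ^ C.card := by
  set μ := multivariateGaussian 0 Γ with hμ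
  set η : ℝ := exp a * (exp (-((κ / 2 - b) * Ψ ^ 2)) * ((1 - θ) ^ (-(κ * γ / (2 * θ)))) ^ v) with hη
  simp_rw [prod_one_add]
  rw [integral_finsetSum _ fun L _ => integrable_prod_cellWeight hΓ hΓop cell hdisj hκ hθ1 hκθ hb L Ψ a]
  calc ∑ L ∈ C.powerset, ∫ ω : EuclideanSpace ℝ ι, ∏ p ∈ L, ((if Ψ ^ 2 ≤ ∑ x ∈ cell p, ω x ^ 2 then (1 : ℝ) else 0) *
          (exp a * exp (b * ∑ x ∈ cell p, ω x ^ 2))) ∂μ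
      ≤ ∑ L ∈ C.powerset, η ^ L.card :=
        sum_le_sum fun L _ => integral_prod_cellWeight_le hΓ hΓop hdiag hγ cell hdisj hv hκ hθ0 hθ1 hκθ hb L Ψ a
    _ = ∑ L ∈ C.powerset, η ^ L.card * (1 : ℝ) ^ (C.card - L.card) := by simp
    _ = (η + 1) ^ C.card := sum_pow_mul_eq_add_pow η 1 C
    _ = (1 + η) ^ C.card := by rw [add_comm]

/-- **THE RESUMMATION, EXPONENTIAL FORM**: under the same hypotheses,
`∫ ∏_{p∈C}(1 + 1_{p large}e^{a}e^{bΣ_{cell p}ψ²}) dN(0,Γ) ≤ exp(#C · e^{a}·e^{−(κ∕2−b)Ψ²}A^v)` (`1 + x ≤ e^x`). [folklore] -/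
theorem integral_prod_one_add_cellWeight_le_exp {Γ : Matrix ι ι ℝ} {γop γ : ℝ} (hΓ : Γ.PosSemidef)
    (hΓop : (γop • (1 : Matrix ι ι ℝ) - Γ).PosSemidef) (hdiag : ∀ i, Γ i i ≤ γ) (hγ : 0 ≤ γ) (cell : V → Finset ι)
    (hdisj : ∀ p q, p ≠ q → Disjoint (cell p) (cell q)) {v : ℕ} (hv : ∀ p, (cell p).card ≤ v) {κ θ b : ℝ} (hκ : 0 ≤ κ) (hθ0 : 0 < θ)
    (hθ1 : θ < 1) (hκθ : κ * γop ≤ θ) (hb : b ≤ κ / 2) (C : Finset V) (Ψ a : ℝ) :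
    ∫ ω : EuclideanSpace ℝ ι, ∏ p ∈ C, (1 + (if Ψ ^ 2 ≤ ∑ x ∈ cell p, ω x ^ 2 then (1 : ℝ) else 0) *
        (exp a * exp (b * ∑ x ∈ cell p, ω x ^ 2))) ∂(multivariateGaussian 0 Γ) ≤
      exp (C.card * (exp a * (exp (-((κ / 2 - b) * Ψ ^ 2)) * ((1 - θ) ^ (-(κ * γ / (2 * θ)))) ^ v))) := by
  set η : ℝ := exp a * (exp (-((κ / 2 - b) * Ψ ^ 2)) * ((1 - θ) ^ (-(κ * γ / (2 * θ)))) ^ v) with hη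
  have hη0 : 0 ≤ η := by positivity
  refine (integral_prod_one_add_cellWeight_le hΓ hΓop hdiag hγ cell hdisj hv hκ hθ0 hθ1 hκθ hb C Ψ a).trans ?_
  calc (1 + η) ^ C.card ≤ (exp η) ^ C.card := pow_le_pow_left₀ (by linarith) (by linarith [add_one_le_exp η]) _
    _ = exp (C.card * η) := by rw [← Real.exp_nat_mul]

/-! ## §5. Toy -/

/-- Toy (§3 with `L = ∅`): the empty product of cell weights is `e^{a·0}·(1·e^{b·0})`. -/
example (cell : Unit → Finset (Fin 1)) (Ψ a b : ℝ) (ω : EuclideanSpace ℝ (Fin 1)) :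
    ∏ p ∈ (∅ : Finset Unit), ((if Ψ ^ 2 ≤ ∑ x ∈ cell p, ω x ^ 2 then (1 : ℝ) else 0) * (exp a * exp (b * ∑ x ∈ cell p, ω x ^ 2))) =
      exp (((∅ : Finset Unit).card) * a) * ((if ∀ p ∈ (∅ : Finset Unit), Ψ ^ 2 ≤ ∑ x ∈ cell p, ω x ^ 2 then (1 : ℝ) else 0) *
        exp (b * ∑ x ∈ (∅ : Finset Unit).biUnion cell, ω x ^ 2)) :=
  prod_cellWeight_eq cell (fun p q hpq => absurd (Subsingleton.elim p q) hpq) ∅ Ψ a b ω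

end Summit.QuantumFields.BalabanUV.T4Continuum.NE7b.SupLargeFieldPenaltyPaid
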